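import Summits.BirchSwinnertonDyer.BirchSwinnertonDyer.Theses.SignedLowerHalves
import Summits.BirchSwinnertonDyer.BirchSwinnertonDyer.Theorems.SignedLowerHalvesKobayashiLowerHalfLargeImageSignDefectX7
import Summits.BirchSwinnertonDyer.BirchSwinnertonDyer.Theorems.SignedLowerHalvesKobayashiLowerHalfLargeImageMuFloorSupply
import Summits.BirchSwinnertonDyer.BirchSwinnertonDyer.Theorems.SignedLowerHalvesKobayashiMainConjectureSmallImageOrbitSumMu
import HarnessLib

/-!
# Route `SignedLowerHalves`, child crux L `SmallImageLowerHalfBothSigns` (item stmt-BirchSwinnertonDyer-23599), line `birth_acns`: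
# the `μ`-rider of the line — THE SIGN IS IDLE on class X7, so the BOTH-signs analytic rider `stub_muBothSigns_ns`
# (Perrin-Riou Conj. 6.1.1 / Pollack Conj. 6.3 on the small-image class, OPEN) is NOT needed: child L follows BY NAME from its
# ONE-sign (`∃ ε`) form and four HELD facts; the one-sign rider (retired item 23117 `SmallImageOneSignUnitContent`) follows from
# Conjecture B⁰ with no image hypothesis; at `p = 3` it is input-free; and the per-pair certificate form of the v14 rider
# (cell `bsd-ssimc`, width seat `bsd-line-slh-p3-w2` g0 under LEAD slh-p3; helper file, `--supports stmt-BirchSwinnertonDyer-23599`; THEOREMS ONLY)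

HONEST FRAMING.  Child L (the integral Eisenstein half of Kobayashi's signed main conjecture at BOTH signs on the residually
`K`-dihedral supersingular class), crux 4 and BSD are OPEN and NOT proved by anything here.  No definition, no named fact minted,
no `sorry`; every theorem is either input-free or an implication whose non-proved inputs are DISPLAYED antecedents: Kobayashi 2003
Thm. 1.2 (`thm12_signedSelmerDual_finite_torsion`), the period-unit pair (`realPeriodRat_eq_unit_mul_plusPeriod[_three]`), the JOINT
Coleman–Kato package construction fact (`Kobayashi2003.thm62_63_73_signedColemanKato_zetaJoint`, ACCEPTED Literature named fact, no
`_holds`), Conjecture B⁰ (`TeichSpanGenAll`, the tree's OPEN group-theoretic conjecture of cell `bsd-f3-mu`), or the `∃`-sign form of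
child L itself.

## What the registered stub asked, and why it is the wrong currency (D-0014, numbers not adjectives)

The LEAD's skeleton v14 (`Cruxes/SmallImageLowerHalfBothSigns/Lines/birth_acns.lean`, sha16 1f0ed6fd7ed827ce) carries
`stub_muBothSigns_ns`: at EVERY pair of the class (odd `p`, `ClassX7`, non-CM, `a_p = 0`, `¬Surj`) and EVERY sign `ε`,
`∃ L₀, IsSignedPAdicLFunction f p ε L₀ ∧ HasUnitContent L₀`, i.e. `μ(L_p⁺(E)) = μ(L_p⁻(E)) = 0`.  That is Perrin-Riou's Conjecture
6.1.1 = Pollack 2003 Conj. 6.3 (Pollack–Weston, Duke 156 (2011), Rem. 4.2 (1): «Perrin-Riou conjectured that μ⁺(f, ωⁱ) = μ⁻(f, ωⁱ) = 0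
… an analogue of Greenberg's conjecture»; idem p. 3: «it is conjectured that … μ^±(g) = 0 when g is non-ordinary») restricted to a class
that is INFINITE (it is closed under quadratic twists by `d` prime to `pN`: good supersingular `a_p = 0`, `¬Semistable`, non-CM and
«image inside the normaliser of the non-split Cartan» are all twist-stable), OPEN for each sign separately; in print as of 2026-08:
only `μ⁺ ≤ 2 ∧ μ⁻ ≤ 1` for almost all `p` per FIXED `E` under the main conjecture and `λ^± ≤ 1` (Gajek-Leonard, Canad. Math. Bull. 2025,
Thm. 1.1; Chakravarthy's method), congruence-invariance of the vanishing (B. D. Kim 2009 Cor. 2.13 / Hatley–Lei 2019 Thm. 4.6 algebraic;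
Corpuz–Lei arXiv:2508.09733, to appear Math. Z., analytic), and per-pair finite certificates.  In the TREE: `min(μ⁺, μ⁻) = 0` is
input-free at `p = 3` (`LargeImageMuFloor.signedMuFloor_three`) and Conjecture B⁰ at `p ≥ 5` (`…signedMuFloor_of_teichSpanGenAll`);
nothing gives the second sign class-wide.

## Why the line does not need it (the vet's KEY n1 on 23599, executed)

On class X7 at an odd `p` with `a_p = 0` the sign of the INTEGRAL Eisenstein half is idle:
`SignDefect.X7.exists_kobayashiLowerDivisibility_iff_forall` (slh-p1 LEAD g4; Kobayashi Thm. 7.4's proof — the `+` and `−` four-term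
sequences start at the same `𝐇¹/Z`, so `char X^ε ⊆ (L_p^ε)` at one sign is Kato's sign-free Eisenstein inclusion `char X₀ ⊆ char(𝐇¹/Z)`),
granted `h12`, `h5`/`h3` and the JOINT package `hJ`.  Hence:
* §1 `smallImageLowerHalfBothSigns_of_exists_sign` — child L BY NAME from «`∃ ε, KobayashiLowerDivisibility W p ε` on the class» and the
  four facts; `smallImageLowerHalfBothSigns_iff_exists_sign` — the equivalence.  So the line's v13 composition (rational engines +
  the ONE-sign rider, which gave the integral half at the rider's sign) reaches child L with NO both-signs statement; the
  re-threaded skeleton is filed as `Cruxes/SmallImageLowerHalfBothSigns/Lines/birth_acns_v15w2.lean` for the LEAD (7 stubs, the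
  rider being the retired item 23117's text verbatim, plus `hJ` cite-only).
* §2 the ONE-sign rider: `smallImageOneSignUnitContent_of_teichSpanGenAll` — the retired route decl `SmallImageOneSignUnitContent`
  (item 23117: `5 ≤ p`, `∃ ε₀ L₀`) from Conjecture B⁰ ALONE (no image / CM hypothesis used); `exists_sign_signed_hasUnitContent_three`
  — the same conclusion at `p = 3` INPUT-FREE; `exists_sign_signed_hasUnitContent_of_forall_sign` — v14's both-signs rider trivially
  implies it (the proposal WEAKENS the stub).
* §3 the per-pair certificate form of the v14 rider, for the census harvest: `forall_sign_exists_signed_hasUnitContent_of_norm_coeff_eq_one`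
  — ONE unit group-ring coefficient of `θ_{n₁}(f)` with `n₁` even AND one of `θ_{n₂}(f)` with `n₂` odd give
  `∀ ε, ∃ L₀, IsSignedPAdicLFunction f p ε L₀ ∧ HasUnitContent L₀` at that pair (both parities are needed: the three-term relation at
  `a_p = 0` links levels of equal parity only).

References: [Kobayashi2003] Thm. 1.2, Thm. 5.2 iv), Thm. 6.2/6.3, Thm. 7.3 i) (7.21), Thm. 7.4 and its proof (p. 13), (3.4)–(3.6);
[Kato2004Asterisque] Conj. 12.10, Thm. 12.5/12.6; [PollackWeston2011] Thm. 4.1 (1), Rem. 4.2; [Pollack2003] Conj. 6.3, Thm. 5.6, Prop. 6.18;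
Gajek-Leonard, Canad. Math. Bull. 2025, Thm. 1.1 (status of print only; not used); tree: `…LargeImageSignDefectX7` (slh-p1 g4), `…LargeImageMuFloorSupply`
(slh-p1-w6 g0), `…SmallImageOrbitSumMu` (slh-p3 g8).
-/

-- D-0017: single-problem summit, the namespace repeats the problem name by design.
set_option linter.dupNamespace false
set_option autoImplicit false

noncomputable section

open scoped Classical MatrixGroups ModularForm

open Polynomial CongruenceSubgroup WeierstrassCurve Literature.NumberTheory.EllipticCurves
  Literature.NumberTheory.EllipticCurves.ModularForms Literature.NumberTheory.EllipticCurves.Kobayashi2003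
  Literature.NumberTheory.EllipticCurves.GreenbergVatsal2000 Literature.NumberTheory.EllipticCurves.Rank1Residual
  Summit.BirchSwinnertonDyer.Rank1Residual.Supersingular
  Summit.BirchSwinnertonDyer.BirchSwinnertonDyer.Theses.SignedLowerHalves

namespace Summit.BirchSwinnertonDyer.BirchSwinnertonDyer.Theorems.SmallImageLowerHalfSignIdle

open Summit.BirchSwinnertonDyer.BirchSwinnertonDyer.Cruxes.AnalyticMuZeroX9.TeichSpan (TeichSpanGenAll)
open Summit.BirchSwinnertonDyer.BirchSwinnertonDyer.Theorems.LargeImageMuFloor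
  (exists_sign_forall_isNewformOf signedMuFloor_three' signedMuFloor_of_teichSpanGenAll_of_five_le)
open Summit.BirchSwinnertonDyer.BirchSwinnertonDyer.Theorems.SmallImageOrbitSumMu
  (exists_isSignedPAdicLFunction_hasUnitContent_of_norm_coeff_eq_one)

/-! ## §1 Child L BY NAME from its one-sign form: the sign is idle on class X7 -/

section SignIdle

/-- **Child L `SmallImageLowerHalfBothSigns` from its `∃`-sign form.**  Granted BY NAME Kobayashi 2003 Thm. 1.2 (`h12`), the period-unit
pair (`h5`, `h3`) and the JOINT Coleman–Kato package construction fact (`hJ`): if at every pair of child L's domain (odd `p`, `ClassX7`,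
non-CM, `a_p = 0`, `ρ̄_{E,p}` not onto) the integral Eisenstein half `char X^ε ⊆ (L_p^ε)` holds for SOME sign, then it holds for EVERY
sign — i.e. the route decl `SmallImageLowerHalfBothSigns` (item 23599).  The cross-sign step is
`SignDefect.X7.exists_kobayashiLowerDivisibility_iff_forall` (no image hypothesis; `¬CM`, `¬Surj` are only threaded).
[cite: Kobayashi2003, Thm. 7.4 and its proof (p. 13)] [cite: Kato2004Asterisque, Conj. 12.10 (p. 224)] -/
theorem smallImageLowerHalfBothSigns_of_exists_sign
    (h12 : thm12_signedSelmerDual_finite_torsion)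
    (h5 : realPeriodRat_eq_unit_mul_plusPeriod) (h3 : realPeriodRat_eq_unit_mul_plusPeriod_three)
    (hJ : thm62_63_73_signedColemanKato_zetaJoint)
    (hone : ∀ (W : WeierstrassCurve ℚ) [W.IsElliptic] [W.IsGloballyMinimal] (p : ℕ) [Fact p.Prime],
      p ≠ 2 → ClassX7 W p → ¬ W.HasCM → W.frobeniusTrace p = 0 → ¬ Surj W p →
      ∃ ε : ℤˣ, KobayashiLowerDivisibility W p ε) :
    SmallImageLowerHalfBothSigns := by
  intro W _ _ p _ hp2 hX hCM hap hs ε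
  exact (SignDefect.X7.exists_kobayashiLowerDivisibility_iff_forall W p h12 h5 h3 hJ hp2 hX hap).mp
    (hone W p hp2 hX hCM hap hs) ε

/-- **Conversely** (no facts): child L gives its `∃`-sign form (take `ε = 1`). [cite: Kobayashi2003, Conjecture (Main Conjecture) (p. 2)] -/
theorem exists_sign_of_smallImageLowerHalfBothSigns (h : SmallImageLowerHalfBothSigns) :
    ∀ (W : WeierstrassCurve ℚ) [W.IsElliptic] [W.IsGloballyMinimal] (p : ℕ) [Fact p.Prime],
      p ≠ 2 → ClassX7 W p → ¬ W.HasCM → W.frobeniusTrace p = 0 → ¬ Surj W p →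
      ∃ ε : ℤˣ, KobayashiLowerDivisibility W p ε :=
  fun W _ _ p _ hp2 hX hCM hap hs ↦ ⟨1, h W p hp2 hX hCM hap hs 1⟩

/-- **The sign of child L is idle** (granted `h12`, `h5`, `h3`, `hJ`): `SmallImageLowerHalfBothSigns` ⟺ its `∃`-sign form.  READING FOR
THE PEN: the LEAD's card (v14, «READING (1)/(3)») weighed the variant «L∃» against «L» on the ground that the glue would then need child M
at the SAME sign; with the sign idle, L∃ ∧ (h12, h5, h3, hJ) ⟹ L, so the filed glue 23602 (L → M → inputs → crux 4) is reached from L∃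
unchanged. [cite: Kobayashi2003, Thm. 7.4 and its proof (p. 13)] -/
theorem smallImageLowerHalfBothSigns_iff_exists_sign
    (h12 : thm12_signedSelmerDual_finite_torsion)
    (h5 : realPeriodRat_eq_unit_mul_plusPeriod) (h3 : realPeriodRat_eq_unit_mul_plusPeriod_three)
    (hJ : thm62_63_73_signedColemanKato_zetaJoint) :
    SmallImageLowerHalfBothSigns ↔
    ∀ (W : WeierstrassCurve ℚ) [W.IsElliptic] [W.IsGloballyMinimal] (p : ℕ) [Fact p.Prime],
      p ≠ 2 → ClassX7 W p → ¬ W.HasCM → W.frobeniusTrace p = 0 → ¬ Surj W p →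
      ∃ ε : ℤˣ, KobayashiLowerDivisibility W p ε :=
  ⟨exists_sign_of_smallImageLowerHalfBothSigns,
    smallImageLowerHalfBothSigns_of_exists_sign h12 h5 h3 hJ⟩

end SignIdle

/-! ## §2 The ONE-sign analytic rider: from Conjecture B⁰ at `p ≥ 5`, input-free at `p = 3`, and implied by the v14 rider -/

section OneSign

variable {W : WeierstrassCurve ℚ} [W.IsElliptic] [W.IsGloballyMinimal] {p : ℕ} [Fact p.Prime]

/-- **Pollack-pair currency ⟹ signed currency**: if SOME sign `ε` has `HasUnitContent (kobayashiL ε L⁺ L⁻)` for every Pollack pair of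
the newform `f` of `W` at the odd good prime `p` with `a_p = 0`, then `∃ ε L₀, IsSignedPAdicLFunction f p ε L₀ ∧ HasUnitContent L₀`
(a Pollack pair EXISTS — tree theorem `pollack_exists_plusMinusPAdicLFunction_holds` — and `kobayashiL ε L⁺ L⁻` is Kobayashi's
`L_p^ε`, `IsPollackPair.isSignedPAdicLFunction_kobayashiL`). [cite: Kobayashi2003, Thm. 3.2 and (3.4)–(3.6) (p. 7)] [cite: Pollack2003, Thm. 5.6, Prop. 6.18] -/
theorem exists_sign_signed_hasUnitContent_of_pollackPair (hp2 : p ≠ 2) [NeZero (W.conductorNorm ℤ)]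
    {f : CuspForm (Gamma0 (W.conductorNorm ℤ)) 2} (hf : IsNewformOf W f)
    (hgood : W.HasGoodReductionAtPrime p) (hap : W.frobeniusTrace p = 0)
    (h : ∃ ε : ℤˣ, ∀ Lplus Lminus : IwasawaAlgebra p, IsPollackPair f p Lplus Lminus →
      HasUnitContent (kobayashiL ε Lplus Lminus)) :
    ∃ (ε : ℤˣ) (L₀ : IwasawaAlgebra p), IsSignedPAdicLFunction f p ε L₀ ∧ HasUnitContent L₀ := by
  obtain ⟨ε, hε⟩ := h
  obtain ⟨Lplus, Lminus, hPP⟩ :=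
    exists_isPollackPair pollack_exists_plusMinusPAdicLFunction_holds hp2 hf hgood hap
  exact ⟨ε, kobayashiL ε Lplus Lminus, hPP.isSignedPAdicLFunction_kobayashiL ε, hε Lplus Lminus hPP⟩

/-- **The one-sign rider at `p ≥ 5` from Conjecture B⁰ ALONE — the retired route decl `SmallImageOneSignUnitContent` (item
stmt-BirchSwinnertonDyer-23117) BY NAME.**  GRANTED the tree's Conjecture B⁰ `TeichSpanGenAll` (OPEN; a hypothesis, never asserted): for
every pair of the small-image class with `5 ≤ p` and its conductor-level newform `f`, some sign `ε₀` and some `L₀` with Pollack's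
parity-`ε₀` congruences and unit content.  Only good reduction at `p` (from `ClassX7`) and `a_p = 0` are used — the class, CM and image
binders are idle (`LargeImageMuFloor.signedMuFloor_of_teichSpanGenAll_of_five_le` has no image hypothesis).
[cite: PollackWeston2011, Thm. 4.1 (1), Rem. 4.2] [cite: MazurTateTeitelbaum1986Invent, §I.10 (10.1)] -/
theorem smallImageOneSignUnitContent_of_teichSpanGenAll (hB : TeichSpanGenAll) : SmallImageOneSignUnitContent := by
  intro W _ _ p _ hp5 hX _ hap _ _ f hf
  have hp2 : p ≠ 2 := by omega
  obtain ⟨ε, hε⟩ := signedMuFloor_of_teichSpanGenAll_of_five_le (W := W) hB hp5 hX.1.1 hap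
  exact exists_sign_signed_hasUnitContent_of_pollackPair hp2 hf hX.1.1 hap ⟨ε, hε f hf⟩

/-- **The one-sign rider at `p = 3`, INPUT-FREE, in the stub's signed currency**: for `W/ℚ` globally minimal with good reduction at `3`
and `a₃ = 0`, and its conductor-level newform `f`, some sign `ε₀` and some `L₀` with `IsSignedPAdicLFunction f 3 ε₀ L₀ ∧ HasUnitContent L₀`
(THEOREM B road: `LargeImageMuFloor.signedMuFloor_three'`, Vaserstein 1972 + Serre 1970 Prop. 12 + Pollack Prop. 6.18 integrally, all
proved in the tree).  So at the `p = 3` pairs of child L the `μ`-rider of the sign-idle line is NOTHING.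
[cite: PollackWeston2011, Thm. 4.1 (1), Rem. 4.2] [cite: Vaserstein1972SL2, Theorem] -/
theorem exists_sign_signed_hasUnitContent_three [NeZero (W.conductorNorm ℤ)]
    {f : CuspForm (Gamma0 (W.conductorNorm ℤ)) 2} (hf : IsNewformOf W f)
    (hgood : W.HasGoodReductionAtPrime 3) (hap : W.frobeniusTrace 3 = 0) :
    ∃ (ε₀ : ℤˣ) (L₀ : IwasawaAlgebra 3), IsSignedPAdicLFunction f 3 ε₀ L₀ ∧ HasUnitContent L₀ := by
  obtain ⟨ε, hε⟩ := signedMuFloor_three' (W := W) hgood hap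
  exact exists_sign_signed_hasUnitContent_of_pollackPair (by decide) hf hgood hap ⟨ε, hε f hf⟩

/-- **v14's BOTH-signs rider implies the one-sign rider** (the v15-w2 proposal WEAKENS the registered stub): from
`∀ ε, ∃ L₀, IsSignedPAdicLFunction f p ε L₀ ∧ HasUnitContent L₀` take `ε = 1`. [cite: Kobayashi2003, (3.4) (p. 7)] -/
theorem exists_sign_signed_hasUnitContent_of_forall_sign {N : ℕ} {f : CuspForm (Gamma0 N) 2}
    (h : ∀ ε : ℤˣ, ∃ L₀ : IwasawaAlgebra p, IsSignedPAdicLFunction f p ε L₀ ∧ HasUnitContent L₀) :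
    ∃ (ε₀ : ℤˣ) (L₀ : IwasawaAlgebra p), IsSignedPAdicLFunction f p ε₀ L₀ ∧ HasUnitContent L₀ :=
  ⟨1, h 1⟩

/-- **The registered v14 stub `stub_muBothSigns_ns` (its statement, as a hypothesis) implies the retired item 23117
`SmallImageOneSignUnitContent`** — so replacing the former by the latter in the skeleton is a weakening, not a change of subject.
[cite: PollackWeston2011, Rem. 4.2] -/
theorem smallImageOneSignUnitContent_of_bothSigns
    (hboth : ∀ (W : WeierstrassCurve ℚ) [W.IsElliptic] [W.IsGloballyMinimal] (p : ℕ) [Fact p.Prime],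
      p ≠ 2 → ClassX7 W p → ¬ W.HasCM → W.frobeniusTrace p = 0 → ¬ Surj W p →
      ∀ [NeZero (W.conductorNorm ℤ)] (f : CuspForm (Gamma0 (W.conductorNorm ℤ)) 2),
      IsNewformOf W f → ∀ ε : ℤˣ, ∃ L₀ : IwasawaAlgebra p,
        IsSignedPAdicLFunction f p ε L₀ ∧ HasUnitContent L₀) :
    SmallImageOneSignUnitContent := by
  intro W _ _ p _ hp5 hX hCM hap hs _ f hf
  have hp2 : p ≠ 2 := by omega
  exact exists_sign_signed_hasUnitContent_of_forall_sign (hboth W p hp2 hX hCM hap hs f hf)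

end OneSign

/-! ## §3 The per-pair certificate form of the v14 rider (both parities) -/

section Certificates

variable {W : WeierstrassCurve ℚ} [W.IsElliptic] [W.IsGloballyMinimal] {p : ℕ} [Fact p.Prime]

/-- **Both signs at one pair from TWO certificates.**  `p` odd, `W/ℚ` globally minimal with good reduction at `p` and `a_p = 0`, `f` its
newform (any level `N`): if for some EVEN level `n₁` and some ODD level `n₂` the group-ring coefficients
`coeff_{s₁}(θ_{n₁}(f) ∘ (T−1))` and `coeff_{s₂}(θ_{n₂}(f) ∘ (T−1))` (ω⁰ orbit sums of plus modular symbols) are `p`-adic UNITS, then for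
EVERY sign `ε` Kobayashi's `L_p^ε` exists with unit content: `∀ ε, ∃ L₀, IsSignedPAdicLFunction f p ε L₀ ∧ HasUnitContent L₀` — the
conclusion of `stub_muBothSigns_ns` AT THAT PAIR.  Both parities are needed: at `a_p = 0` the three-term relation links `θ_{n+1}`
to `θ_{n-1}` only, so `μ(L_p⁺)` and `μ(L_p⁻)` are read on disjoint sets of layers.
[cite: PollackWeston2011, Thm. 4.1 (1)] [cite: Pollack2003, Thm. 5.6 and Prop. 6.18] -/
theorem forall_sign_exists_signed_hasUnitContent_of_norm_coeff_eq_one (hp2 : p ≠ 2) {N : ℕ} [NeZero N]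
    {f : CuspForm (Gamma0 N) 2} (hf : IsNewformOf W f)
    (hgood : W.HasGoodReductionAtPrime p) (hap : W.frobeniusTrace p = 0) {n₁ s₁ n₂ s₂ : ℕ}
    (hn₁ : Even n₁) (hn₂ : Odd n₂)
    (hunit₁ : ‖((((mazurTateElement f p n₁).comp (X - 1)).coeff s₁ : ℚ) : ℚ_[p])‖ = 1)
    (hunit₂ : ‖((((mazurTateElement f p n₂).comp (X - 1)).coeff s₂ : ℚ) : ℚ_[p])‖ = 1) :
    ∀ ε : ℤˣ, ∃ L₀ : IwasawaAlgebra p, IsSignedPAdicLFunction f p ε L₀ ∧ HasUnitContent L₀ := by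
  intro ε
  rcases Int.units_eq_one_or ε with rfl | rfl
  · exact exists_isSignedPAdicLFunction_hasUnitContent_of_norm_coeff_eq_one hp2 hf hgood hap
      (Or.inl ⟨hn₁, rfl⟩) hunit₁
  · exact exists_isSignedPAdicLFunction_hasUnitContent_of_norm_coeff_eq_one hp2 hf hgood hap
      (Or.inr ⟨hn₂, rfl⟩) hunit₂

end Certificates

end Summit.BirchSwinnertonDyer.BirchSwinnertonDyer.Theorems.SmallImageLowerHalfSignIdle

end
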